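import Summits.SmoothPoincare4.SmoothPoincare4.Theses.CongruenceShadows
import Literature.Topology.FourManifolds.GroupTrisectionsConnectSum
import Summits.SmoothPoincare4.SmoothPoincare4.Theorems.AgkCor6Sufficiency.Negative.DownwardClosed

/-!
# `NormalFormStablyTrivial` — line `Sketch`: vocabulary and TRANSFER `K1 ∧ K2 ⇒ crux`

Vocabulary-and-transfer file of the proof line `Sketch` (crux idea `primitive-reducing-systems`,
ideator 2; triage r1-1 / r1-2: pass) for the crux `CongruenceShadows.NormalFormStablyTrivial`
(item stmt-SmoothPoincare4-14591, route route-SmoothPoincare4-CongruenceShadows; checked skeleton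
`Cruxes/NormalFormStablyTrivial/Lines/Sketch.lean`, lead prover
prover-line-stmt-SmoothPoincare4-14591-0).  It carries the two statements the line posits — the
registered stubs of the skeleton, verbatim — and PROVES the registered transfer
`transfer_normalFormStablyTrivial : StablyThreeHandleFree → ThreeHandleFreeStablyTrivial →
NormalFormStablyTrivial` (the skeleton's composition, sorry-free, axioms standard).  Both
statements are conjecture-grade: each is implied by SPC4 (K2 verbatim through Abrams–Gay–Kirby's
condition; K1 through the calibration "the standard triple is a one-direction connected sum",
companion file `…SketchCalibration.lean`) and their conjunction gives the crux (this file).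

* `StablyThreeHandleFree` (K1) — every Waldhausen-normalised `(3+3m, m+1)` group trisection `K`
  of the trivial group (Abrams–Gay–Kirby kernel form, `IsGroupTrisection`) becomes, after `n`
  stabilisations and the genus bookkeeping `3+3m+3n = 2(m+1+n) + (m+1+n)`, isomorphic to the
  connected sum (`TrisectionKernels.connectSum`, AGK Def. 2) of SOME genus-`2(m+1+n)` triple `K''`
  with the genus-`(m+1+n)` **eye triple in one direction `j`** — slot `j` kills `b₁,…,b_r`, the two
  other slots kill `a₁,…,a_r` (for `r = 1` this is `unbalancedKernels j`, and
  `K.stabilizeOne j = K # unbalancedKernels j` is Gay–Kirby's unbalanced stabilisation; the balanced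
  stabilisation is three of them, `stabilize_eq_stabilizeOne`).  By the Gay–Kirby handle dictionary
  the sector `X_j` of such a triple is a 4-ball: K1 is the kernel form of "every homotopy 4-sphere
  has a handle decomposition without 3-handles, i.e. (dually) is geometrically simply connected" —
  Kirby's Problem 4.18 restricted to homotopy 4-spheres (route NoOneHandles' `NoohNoOneHandles`).
* `ThreeHandleFreeStablyTrivial` (K2) — every `(3r, r)` group trisection of the trivial group
  isomorphic to such a one-direction connected sum is stably trivial: the kernel form of "a
  geometrically simply connected homotopy 4-sphere is `S⁴`" (weak generalised Property R; route
  NoOneHandles' `NoohGscStandard`), stated `Iso`-closed (kernel triples live up to `Iso`) — which is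
  what makes the transfer independent of the `Iso`-invariance of `IsStablyTrivial` (Nielsen's
  lifting theorem, not in the tree; `Cruxes/NormalFormStablyTrivial/Disproof.lean` §4).
* `threeHandleFreeStablyTrivial_of_agkCondition` — Abrams–Gay–Kirby's condition `X` (hence SPC4)
  implies K2 (casts only).  (`X ⇒ K1` goes through the calibration "the standard triple is a
  one-direction connected sum" of `…SketchCalibration.lean` and is recorded in the companion file
  `…SketchConsequences.lean`.)
* `transfer_normalFormStablyTrivial` — K1 gives `n, j, K''` and
  `Iso ((K.stabilizeIter n).cast h) (K'' # eyes)`; `IsGroupTrisection` ascends the `n`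
  stabilisations (`isGroupTrisection_stabilizeIter`) and crosses `h` (`isGroupTrisection_cast`);
  K2 gives stable triviality of the cast triple; come back with `isStablyTrivial_cast_iff` and
  descend with `isStablyTrivial_of_stabilizeIter` (`StablyTrivialTight.lean`, `DownwardClosed.lean`).

The eye triple is written inline (`normalClosure (Set.range …)`) so that the statements mention
only declarations of `GroupTrisections.lean` / `GroupTrisectionsConnectSum.lean`.
Sources: A. Abrams, D. Gay, R. Kirby, *Group trisections and smooth 4-manifolds*, Geom. Topol. 22
(2018), Def. 1–3, Cor. 6; D. Gay, R. Kirby, *Trisecting 4-manifolds*, Geom. Topol. 20 (2016),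
Lemma 10, §4 (handles from a trisection); R. Kirby, *Problems in low-dimensional topology* (1997),
4.18; R. Gompf, M. Scharlemann, A. Thompson, Geom. Topol. 14 (2010), Prop. 9.2.
-/

noncomputable section

-- the prescribed namespace `Summit.<P>.<Sub>.…` duplicates `SmoothPoincare4` (P = Sub)
set_option linter.dupNamespace false

namespace Summit.SmoothPoincare4.SmoothPoincare4.Theorems.NormalFormStablyTrivial.Sketch

open Literature.Topology.FourManifolds Subgroup
open Summit.SmoothPoincare4.SmoothPoincare4.Theses.CongruenceShadows (NormalFormStablyTrivial)
open Summit.SmoothPoincare4.SmoothPoincare4.Theorems.AgkCor6Sufficiency.Negative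
  (isGroupTrisection_stabilizeIter isGroupTrisection_cast isStablyTrivial_cast_iff
   isStablyTrivial_of_stabilizeIter)

/-- **K1 — stably 3-handle-free (kernel form of Kirby 4.18 for homotopy 4-spheres).**  For every
Waldhausen-normalised `(3+3m, m+1)` group trisection `K` of the trivial group there are `n`, a
direction `j` and a genus-`2(m+1+n)` kernel triple `K''` such that the `n`-fold stabilisation of
`K`, transported along `3+3m+3n = 2(m+1+n) + (m+1+n)`, is isomorphic (one automorphism of the
surface group) to the connected sum of `K''` with the genus-`(m+1+n)` eye triple in direction `j`
(slot `j` kills the `b`'s, the other two slots the `a`'s of the last `m+1+n` handles). -/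
def StablyThreeHandleFree : Prop :=
  ∀ (m : ℕ) (K : TrisectionKernels (3 + 3 * m)),
    IsGroupTrisection (3 + 3 * m) (m + 1) (PUnit : Type) K →
    (∀ i j : Fin 3, i ≠ j → ∃ α : SurfaceGroup (3 + 3 * m) ≃* SurfaceGroup (3 + 3 * m),
      (s4Kernels.stabilizeIter m i).map α.toMonoidHom = K i ∧
      (s4Kernels.stabilizeIter m j).map α.toMonoidHom = K j) →
    ∃ (n : ℕ) (j : Fin 3) (K'' : TrisectionKernels (2 * (m + 1 + n)))
      (h : 3 + 3 * m + 3 * n = 2 * (m + 1 + n) + (m + 1 + n)),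
      TrisectionKernels.Iso ((K.stabilizeIter n).cast h)
        (K''.connectSum (fun ι => normalClosure (Set.range fun i : Fin (m + 1 + n) =>
          (PresentedGroup.of (i, decide (ι = j)) : SurfaceGroup (m + 1 + n)))))

/-- **K2 — one-direction stabilised trisections of `{1}` are stably trivial (kernel form of "a
geometrically simply connected homotopy 4-sphere is `S⁴`", `Iso`-closed).**  Every `(3r, r)`
group trisection of the trivial group (genus written `2r + r`) that is isomorphic to the connected
sum of a genus-`2r` triple with the genus-`r` eye triple in one direction `j` is stably trivial. -/
def ThreeHandleFreeStablyTrivial : Prop :=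
  ∀ (r : ℕ) (j : Fin 3) (K'' : TrisectionKernels (2 * r)) (K : TrisectionKernels (2 * r + r)),
    IsGroupTrisection (2 * r + r) r (PUnit : Type) K →
    TrisectionKernels.Iso K
      (K''.connectSum (fun ι => normalClosure (Set.range fun i : Fin r =>
        (PresentedGroup.of (i, decide (ι = j)) : SurfaceGroup r)))) →
    K.IsStablyTrivial

/-- **TRANSFER `K1 ∧ K2 ⇒ NormalFormStablyTrivial`** (the composition of the checked skeleton
`Cruxes/NormalFormStablyTrivial/Lines/Sketch.lean`; pure cast bookkeeping, independent of Nielsen's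
lifting theorem because K2 is `Iso`-closed). -/
theorem transfer_normalFormStablyTrivial :
    StablyThreeHandleFree → ThreeHandleFreeStablyTrivial → NormalFormStablyTrivial := by
  intro h1 h2 m K hK hP
  obtain ⟨n, j, K'', h, hiso⟩ := h1 m K hK hP
  -- the `n`-fold stabilisation is a `(3+3m+3n, m+1+n)` trisection of `{1}`; transport it along
  -- the genus bookkeeping `h : 3 + 3m + 3n = 2 (m + 1 + n) + (m + 1 + n)`
  have hKn : IsGroupTrisection (2 * (m + 1 + n) + (m + 1 + n)) (m + 1 + n) (PUnit : Type)
      ((K.stabilizeIter n).cast h) :=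
    isGroupTrisection_cast (isGroupTrisection_stabilizeIter hK n) h
  -- K2 on the transported triple, then come back and descend the `n` stabilisations
  have hst := h2 (m + 1 + n) j K'' _ hKn hiso
  rw [isStablyTrivial_cast_iff] at hst
  exact isStablyTrivial_of_stabilizeIter K n hst

/-! ## Consequences: the logical position of the two stubs

`X ⇒ K1 ∧ K2` where `X` is Abrams–Gay–Kirby's condition ("every `(3k, k)` group trisection of the
trivial group is stably trivial", the hypothesis of the route item `AgkCor6Sufficiency`, itself a
consequence of SPC4 through the `→` half of `spc4_iff_forall_isStablyTrivial`); together with the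
transfer: `X ⇒ K1 ∧ K2 ⇒ NormalFormStablyTrivial` (`X ⇒ K1`: companion file
`…SketchConsequences.lean`, through `calibration`).  So neither stub is refutable short of an
exotic `S⁴`, and the line's split has exactly the strength of the crux (modulo `WaldhausenPairs`). -/

/-- **AGK's condition ⇒ K2** (casts only: `2r + r = 3r`). [folklore] -/
theorem threeHandleFreeStablyTrivial_of_agkCondition
    (hX : ∀ (k : ℕ) (K : TrisectionKernels (3 * k)),
      IsGroupTrisection (3 * k) k (PUnit : Type) K → K.IsStablyTrivial) :
    ThreeHandleFreeStablyTrivial := by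
  intro r j K'' K hK _
  have e : 2 * r + r = 3 * r := by ring
  have h := hX r (K.cast e) (isGroupTrisection_cast hK e)
  rwa [isStablyTrivial_cast_iff] at h

end Summit.SmoothPoincare4.SmoothPoincare4.Theorems.NormalFormStablyTrivial.Sketch

end
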